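import Literature.AlgebraicTopology.CharacteristicClasses.ProjectiveBundleLerayHirsch
import Literature.AlgebraicTopology.CharacteristicClasses.ProjectiveBundleMap
import Literature.AlgebraicTopology.SingularHomology.CohomologyOfFiniteDiscrete
import HarnessLib

/-!
# Grothendieck's definition of the Chern classes and axioms (C₀), (C₁)

D. Husemoller, *Fibre Bundles* (3rd ed. 1994), Ch. 17 Def. 2.6 ("the classes `xᵢ(ξ)` are the
unique classes with `a_ξⁿ = -Σ xᵢ(ξ) a_ξⁿ⁻ⁱ`", Thm. 2.5 giving existence and uniqueness of the
coefficients) and Prop. 3.3 ((C₀), (C₁)). For a complex vector bundle `E` of rank `n` over a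
paracompact Hausdorff base, with `q : P(E) → B` and `x = e(λ) ∈ H²(P(E); R)`:

* `lhSum`: the sums `Σⱼ q^*bⱼ ⌣ xʲ` with freely indexed degrees (to keep the degree arithmetic
  definitional), their relation to the Leray–Hirsch map and their naturality `map_lhSum`;
* `IsChernFamily q x n c` for a family `c : Π i, H²ⁱ(B)`: `c₀ = 1`, `cᵢ = 0` for `i > n`, and
  **`xⁿ + Σ_{j<n} q^*c_{n-j} ⌣ xʲ = 0`**; uniqueness of such a family (`IsChernFamily.unique`,
  injectivity of Leray–Hirsch in degree `2n`) and its transport along maps `u : P(E₁) → P(E₂)`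
  with `u^*x₂ = x₁` (`IsChernFamily.comap`);
* **`chernClassR E R i ∈ H²ⁱ(B; R)`** — the Chern classes (Def. 2.6, from the surjectivity of
  Leray–Hirsch), `isChernFamily_chernClassR`; (C₀) `chernClassR_zero`, `chernClassR_eq_zero_of_lt`;
* **(C₁)** `chernClassR_pullback` (`c(f^*E) = f^*c(E)`) and `chernClassR_congr` (isomorphic bundles),
  via the maps of projective bundles of `ProjectiveBundleMap` and `map_lineEuler_eq`.

(The sign convention is `x = e(λ)`, Husemoller's `-a_ξ`; it only affects the classes by the
automorphism `cᵢ ↦ (-1)ⁱcᵢ`, invisible in the axioms.) Everything is proved; no named facts.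

## References

* D. Husemoller, *Fibre Bundles*, GTM 20, Springer 1994, Ch. 17 Def. 2.6, Thm. 2.5, Prop. 3.3. [HusemollerFibreBundles1994]
-/

noncomputable section

open CategoryTheory Function Set Bundle Module Literature.AlgebraicTopology.SingularHomology
  Literature.AlgebraicTopology.SingularHomology.LerayHirsch
open scoped LinearAlgebra.Projectivization

namespace Literature.AlgebraicTopology.CharacteristicClasses

/-! ### Sums `Σⱼ q^*bⱼ ⌣ xʲ` with free degrees -/

section LHSum

variable (R : Type) [CommRing R] {X' B' : Type} [TopologicalSpace X'] [TopologicalSpace B']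

/-- `degCast` along a proof of `a = a` is the identity. [folklore] -/
theorem degCast_eq_self {X : Type} [TopologicalSpace X] {a : ℕ} (e : a = a) (y : singularCohomology R R X a) : degCast R e y = y := rfl

/-- **`Σⱼ q^*bⱼ ⌣ xʲ ∈ Hᴷ(X')`** for a family `bⱼ ∈ H^{e j}(B')` with `e j + 2j = K`.
[cite: HusemollerFibreBundles1994, Ch. 17 Def. 2.6] -/
def lhSum (q : C(X', B')) (x : singularCohomology R R X' 2) {N K : ℕ} (e : Fin N → ℕ) (h : ∀ j, e j + 2 * (j : ℕ) = K)
    (b : (j : Fin N) → singularCohomology R R B' (e j)) : singularCohomology R R X' K :=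
  ∑ j, cupProduct (h j) (singularCohomology.map R R q (e j) (b j)) (cupPow R x j)

/-- `lhSum` is the Leray–Hirsch map on the cast tuple. [folklore] -/
theorem lhSum_eq_lhMap (q : C(X', B')) (x : singularCohomology R R X' 2) {N K : ℕ} (e : Fin N → ℕ)
    (h : ∀ j, e j + 2 * (j : ℕ) = K) (b : (j : Fin N) → singularCohomology R R B' (e j)) :
    lhSum R q x e h b = lhMap R (evenDeg N) q (fun j ↦ cupPow R x j) K
      (fun j ↦ degCast R (show e j.1 = K - 2 * (j.1 : ℕ) by have := h j.1; omega) (b j.1)) := by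
  rw [lhSum, lhMap_apply]
  refine Finset.sum_congr rfl fun j _ ↦ ?_
  rw [dif_pos (show evenDeg N j ≤ K by have := h j; change 2 * (j : ℕ) ≤ K; omega)]
  change _ = cupProduct _ (singularCohomology.map R R q (K - 2 * (j : ℕ)) (degCast R _ (b j))) (cupPow R x j)
  rw [map_degCast, cupProduct_degCast_left R _ _ (h j)]

/-- **Injectivity of `b ↦ Σⱼ q^*bⱼ ⌣ xʲ`** from that of the Leray–Hirsch map. [cite: HusemollerFibreBundles1994, Ch. 17 Thm. 2.5] -/
theorem lhSum_injective (q : C(X', B')) (x : singularCohomology R R X' 2) {N K : ℕ} (e : Fin N → ℕ)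
    (h : ∀ j, e j + 2 * (j : ℕ) = K) (hinj : Injective (lhMap R (evenDeg N) q (fun j ↦ cupPow R x j) K))
    {b b' : (j : Fin N) → singularCohomology R R B' (e j)} (hb : lhSum R q x e h b = lhSum R q x e h b') : b = b' := by
  rw [lhSum_eq_lhMap, lhSum_eq_lhMap] at hb
  have := hinj hb
  funext j
  have hj := congrFun this ⟨j, by have := h j; change 2 * (j : ℕ) ≤ K; omega⟩
  exact (degCast R _).injective hj

/-- **Naturality of `lhSum`** along a square `q₂ ∘ u = g ∘ q₁` with `u^*x₂ = x₁`:
`u^*(Σ q₂^*bⱼ ⌣ x₂ʲ) = Σ q₁^*(g^*bⱼ) ⌣ x₁ʲ`. [cite: HusemollerFibreBundles1994, Ch. 17 Prop. 3.3 (proof)] -/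
theorem map_lhSum {X₁ B₁ : Type} [TopologicalSpace X₁] [TopologicalSpace B₁] (q₁ : C(X₁, B₁)) (q₂ : C(X', B'))
    (u : C(X₁, X')) (g : C(B₁, B')) (hug : q₂.comp u = g.comp q₁) (x₁ : singularCohomology R R X₁ 2)
    (x₂ : singularCohomology R R X' 2) (hx : singularCohomology.map R R u 2 x₂ = x₁) {N K : ℕ} (e : Fin N → ℕ)
    (h : ∀ j, e j + 2 * (j : ℕ) = K) (b : (j : Fin N) → singularCohomology R R B' (e j)) :
    singularCohomology.map R R u K (lhSum R q₂ x₂ e h b) = lhSum R q₁ x₁ e h (fun j ↦ singularCohomology.map R R g (e j) (b j)) := by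
  rw [lhSum, lhSum, map_sum]
  refine Finset.sum_congr rfl fun j _ ↦ ?_
  rw [cupProduct_map, map_cupPow, hx, ← ModuleCat.comp_apply, ← singularCohomology.map_comp, hug, singularCohomology.map_comp,
    ModuleCat.comp_apply]

/-- `lhSum` is additive in `b`. [folklore] -/
theorem lhSum_add (q : C(X', B')) (x : singularCohomology R R X' 2) {N K : ℕ} (e : Fin N → ℕ) (h : ∀ j, e j + 2 * (j : ℕ) = K)
    (b b' : (j : Fin N) → singularCohomology R R B' (e j)) : lhSum R q x e h (b + b') = lhSum R q x e h b + lhSum R q x e h b' := by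
  rw [lhSum, lhSum, lhSum, ← Finset.sum_add_distrib]
  refine Finset.sum_congr rfl fun j _ ↦ ?_
  rw [Pi.add_apply, map_add, LinearMap.map_add₂]

end LHSum

/-! ### Chern families: the defining relation and its uniqueness -/

section Family

variable (R : Type) [CommRing R] {X' B' : Type} [TopologicalSpace X'] [TopologicalSpace B']

/-- **A Chern family for `(q, x, n)`**: classes `cᵢ ∈ H²ⁱ(B')` with `c₀ = 1`, `cᵢ = 0` for `i > n`
and the defining relation `xⁿ + Σ_{j<n} q^*c_{n-j} ⌣ xʲ = 0` (Husemoller Def. 2.6 with `x = -a_ξ`).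
[cite: HusemollerFibreBundles1994, Ch. 17 Def. 2.6] -/
structure IsChernFamily (q : C(X', B')) (x : singularCohomology R R X' 2) (n : ℕ)
    (c : (i : ℕ) → singularCohomology R R B' (2 * i)) : Prop where
  zero : c 0 = singularCohomology.one R B'
  eq_zero_of_lt : ∀ i, n < i → c i = 0
  rel : cupPow R x n + lhSum R q x (K := 2 * n) (fun j : Fin n ↦ 2 * (n - (j : ℕ))) (fun j ↦ by have := j.isLt; omega) (fun j ↦ c (n - j)) = 0

namespace IsChernFamily

variable {R} {q : C(X', B')} {x : singularCohomology R R X' 2} {n : ℕ} {c c' : (i : ℕ) → singularCohomology R R B' (2 * i)}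

/-- **Uniqueness of Chern families** when Leray–Hirsch is injective in degree `2n`. [cite: HusemollerFibreBundles1994, Ch. 17 Thm. 2.5, Def. 2.6] -/
theorem unique (hc : IsChernFamily R q x n c) (hc' : IsChernFamily R q x n c')
    (hinj : Injective (lhMap R (evenDeg n) q (fun j ↦ cupPow R x j) (2 * n))) : c = c' := by
  have hrel : lhSum R q x (K := 2 * n) (fun j : Fin n ↦ 2 * (n - (j : ℕ))) (fun j ↦ by have := j.isLt; omega) (fun j ↦ c (n - j)) =
      lhSum R q x (K := 2 * n) (fun j : Fin n ↦ 2 * (n - (j : ℕ))) (fun j ↦ by have := j.isLt; omega) (fun j ↦ c' (n - j)) :=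
    add_left_cancel (hc.rel.trans hc'.rel.symm)
  have hcomp := lhSum_injective R q x _ _ hinj hrel
  funext i
  rcases Nat.eq_zero_or_pos i with rfl | hi
  · rw [hc.zero, hc'.zero]
  by_cases hin : i ≤ n
  · have hj := congrFun hcomp ⟨n - i, by omega⟩
    change c (n - (n - i)) = c' (n - (n - i)) at hj
    rwa [Nat.sub_sub_self hin] at hj
  · rw [hc.eq_zero_of_lt i (by omega), hc'.eq_zero_of_lt i (by omega)]

/-- **Transport of Chern families**: along `u : X₁ → X'`, `g : B₁ → B'` with `q₂ ∘ u = g ∘ q₁` and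
`u^*x₂ = x₁`, a Chern family `c` for `(q₂, x₂, n)` gives the Chern family `g^*c` for `(q₁, x₁, n)`.
[cite: HusemollerFibreBundles1994, Ch. 17 Prop. 3.3 (proof)] -/
theorem comap {X₁ B₁ : Type} [TopologicalSpace X₁] [TopologicalSpace B₁] {q₁ : C(X₁, B₁)} (hc : IsChernFamily R q x n c)
    (u : C(X₁, X')) (g : C(B₁, B')) (hug : q.comp u = g.comp q₁) {x₁ : singularCohomology R R X₁ 2}
    (hx : singularCohomology.map R R u 2 x = x₁) :
    IsChernFamily R q₁ x₁ n (fun i ↦ singularCohomology.map R R g (2 * i) (c i)) where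
  zero := by rw [hc.zero, singularCohomology.map_one]
  eq_zero_of_lt i hi := by rw [hc.eq_zero_of_lt i hi, map_zero]
  rel := by
    have h1 := congrArg (singularCohomology.map R R u (2 * n)) hc.rel
    rw [map_add, map_zero, map_cupPow, hx, map_lhSum R q₁ q u g hug x₁ x hx] at h1
    exact h1

end IsChernFamily

end Family

/-! ### The Chern classes of a bundle -/

namespace ComplexVectorBundle

variable {B : Type} [TopologicalSpace B] [T2Space B] [ParacompactSpace B] (E : ComplexVectorBundle.{0, 0} B) (R : Type) [CommRing R]

/-- The coordinate index `0` (rank `≥ 1`). [folklore] -/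
def k0 (hE : 0 < E.rank) : Fin E.rank := ⟨0, hE⟩

/-- `x = e(λ)` for the standard coordinate. [cite: HusemollerFibreBundles1994, Ch. 17 §2] -/
abbrev xClass (hE : 0 < E.rank) : singularCohomology R R E.Proj 2 := E.lineEuler (E.k0 hE) R 1

/-- The classes `xʲ` indexed by `Fin n` are the Leray–Hirsch classes. [folklore] -/
theorem projBundleCls_eq (hE : 0 < E.rank) : E.projBundleCls (E.k0 hE) R = fun j : Fin E.rank ↦ cupPow R (E.xClass R hE) (j : ℕ) := rfl

/-- **The coefficient tuple** as a Leray–Hirsch source: the preimage of `-xⁿ` (surjectivity of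
Leray–Hirsch in degree `2n`). [cite: HusemollerFibreBundles1994, Ch. 17 Def. 2.6] -/
def chernSrc (hE : 0 < E.rank) : Src R (evenDeg E.rank) B (2 * E.rank) :=
  (Equiv.ofBijective _ (E.projectiveBundle_lerayHirsch (E.k0 hE) R (2 * E.rank))).symm (-cupPow R (E.xClass R hE) E.rank)

/-- `θ(b) = -xⁿ`. [cite: HusemollerFibreBundles1994, Ch. 17 Def. 2.6] -/
theorem lhMap_chernSrc (hE : 0 < E.rank) :
    lhMap R (evenDeg E.rank) E.projMap (E.projBundleCls (E.k0 hE) R) (2 * E.rank) (E.chernSrc R hE) = -cupPow R (E.xClass R hE) E.rank :=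
  (Equiv.ofBijective _ (E.projectiveBundle_lerayHirsch (E.k0 hE) R (2 * E.rank))).apply_symm_apply _

/-- **The coefficients** `bⱼ ∈ H²ⁿ⁻²ʲ(B)`, `j < n`, with `xⁿ + Σ q^*bⱼ ⌣ xʲ = 0`. [cite: HusemollerFibreBundles1994, Ch. 17 Def. 2.6] -/
def chernVec (hE : 0 < E.rank) (j : Fin E.rank) : singularCohomology R R B (2 * E.rank - 2 * (j : ℕ)) :=
  E.chernSrc R hE ⟨j, show 2 * (j : ℕ) ≤ 2 * E.rank by have := j.isLt; omega⟩

/-- Its defining relation. [cite: HusemollerFibreBundles1994, Ch. 17 Def. 2.6] -/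
theorem chernVec_rel (hE : 0 < E.rank) :
    cupPow R (E.xClass R hE) E.rank + lhSum R E.projMap (E.xClass R hE) (K := 2 * E.rank) (fun j : Fin E.rank ↦ 2 * E.rank - 2 * (j : ℕ))
      (fun j ↦ by have := j.isLt; omega) (E.chernVec R hE) = 0 := by
  rw [lhSum_eq_lhMap]
  have h1 : (fun j : Idx (evenDeg E.rank) (2 * E.rank) ↦ degCast R (show 2 * E.rank - 2 * (j.1 : ℕ) = 2 * E.rank - 2 * (j.1 : ℕ) from rfl)
      (E.chernVec R hE j.1)) = E.chernSrc R hE := funext fun j ↦ rfl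
  rw [h1, ← projBundleCls_eq, lhMap_chernSrc, add_neg_cancel]

/-- **The Chern classes `cᵢ(E) ∈ H²ⁱ(B; R)`** (Husemoller Def. 2.6): `c₀ = 1`, `cᵢ = b_{n-i}` for
`1 ≤ i ≤ n`, `cᵢ = 0` for `i > n` (and for `n = 0`). [cite: HusemollerFibreBundles1994, Ch. 17 Def. 2.6] -/
def chernClassR (i : ℕ) : singularCohomology R R B (2 * i) :=
  if hi : i = 0 then degCast R (show 0 = 2 * i by omega) (singularCohomology.one R B)
  else if h : i ≤ E.rank ∧ 0 < E.rank then
    degCast R (show 2 * E.rank - 2 * (E.rank - i) = 2 * i by omega) (E.chernVec R h.2 ⟨E.rank - i, by omega⟩)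
  else 0

/-- **(C₀): `c₀(E) = 1`.** [cite: HusemollerFibreBundles1994, Ch. 17 Prop. 3.3] -/
theorem chernClassR_zero : E.chernClassR R 0 = singularCohomology.one R B := by
  rw [chernClassR, dif_pos rfl]
  rfl

/-- **(C₀): `cᵢ(E) = 0` for `i > rank E`.** [cite: HusemollerFibreBundles1994, Ch. 17 Prop. 3.3] -/
theorem chernClassR_eq_zero_of_lt {i : ℕ} (hi : E.rank < i) : E.chernClassR R i = 0 := by
  rw [chernClassR, dif_neg (by omega), dif_neg (by omega)]

/-- Casts of coefficients with equal indices agree (the target degree kept abstract, so that no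
arithmetic is unfolded). [folklore] -/
theorem degCast_chernVec_congr (hE : 0 < E.rank) {a b : Fin E.rank} (hab : a = b) {d : ℕ} (ea : 2 * E.rank - 2 * (a : ℕ) = d)
    (eb : 2 * E.rank - 2 * (b : ℕ) = d) : degCast R ea (E.chernVec R hE a) = degCast R eb (E.chernVec R hE b) := by
  subst hab
  have hpe : ea = eb := proof_irrel _ _
  subst hpe
  exact Eq.refl _

/-- The middle classes are the coefficients: `c_{n-j}(E) = bⱼ` for `j < n`. [folklore] -/
theorem chernClassR_sub (hE : 0 < E.rank) (j : Fin E.rank) :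
    E.chernClassR R (E.rank - j) = degCast R (show 2 * E.rank - 2 * (j : ℕ) = 2 * (E.rank - j) by omega) (E.chernVec R hE j) := by
  have hj := j.isLt
  rw [chernClassR, dif_neg (by omega), dif_pos ⟨Nat.sub_le _ _, hE⟩]
  have hfin : (⟨E.rank - (E.rank - (j : ℕ)), by omega⟩ : Fin E.rank) = j := Fin.ext (Nat.sub_sub_self hj.le)
  have key := E.degCast_chernVec_congr R hE hfin (d := 2 * (E.rank - (j : ℕ))) (by omega) (by omega)
  refine Eq.trans ?_ key
  congr 1

/-- **The Chern classes form a Chern family for `(q, x, n)`** (the defining relation). [cite: HusemollerFibreBundles1994, Ch. 17 Def. 2.6] -/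
theorem isChernFamily_chernClassR (hE : 0 < E.rank) : IsChernFamily R E.projMap (E.xClass R hE) E.rank (E.chernClassR R) where
  zero := E.chernClassR_zero R
  eq_zero_of_lt i hi := E.chernClassR_eq_zero_of_lt R hi
  rel := by
    have h := E.chernVec_rel R hE
    have hsum : lhSum R E.projMap (E.xClass R hE) (K := 2 * E.rank) (fun j : Fin E.rank ↦ 2 * (E.rank - (j : ℕ)))
        (fun j ↦ by have := j.isLt; omega) (fun j ↦ E.chernClassR R (E.rank - j)) =
        lhSum R E.projMap (E.xClass R hE) (K := 2 * E.rank) (fun j : Fin E.rank ↦ 2 * E.rank - 2 * (j : ℕ))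
          (fun j ↦ by have := j.isLt; omega) (E.chernVec R hE) := by
      rw [lhSum, lhSum]
      refine Finset.sum_congr rfl fun j _ ↦ ?_
      rw [E.chernClassR_sub R hE j, map_degCast, cupProduct_degCast_left]
    rw [hsum]
    exact h

/-- `c(E)` is the ONLY Chern family for `(q, x, n)`. [cite: HusemollerFibreBundles1994, Ch. 17 Thm. 2.5, Def. 2.6] -/
theorem eq_chernClassR_of_isChernFamily (hE : 0 < E.rank) {c : (i : ℕ) → singularCohomology R R B (2 * i)}
    (hc : IsChernFamily R E.projMap (E.xClass R hE) E.rank c) : c = E.chernClassR R :=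
  hc.unique (E.isChernFamily_chernClassR R hE) (E.projectiveBundle_lerayHirsch (E.k0 hE) R (2 * E.rank)).1

/-- For rank `0` all classes but `c₀` vanish. [folklore] -/
theorem chernClassR_of_rank_eq_zero (hE : E.rank = 0) {i : ℕ} (hi : i ≠ 0) : E.chernClassR R i = 0 :=
  E.chernClassR_eq_zero_of_lt R (by omega)

/-! ### (C₁): naturality under pull-back and invariance under isomorphism -/

section Pullback

variable {B' : Type} [TopologicalSpace B'] [T2Space B'] [ParacompactSpace B'] (f : C(B', B))

/-- The fibrewise identity `(f^*E)_{b'} = E_{f b'}` as a bundle map `f^*E → E` over `f`. [folklore] -/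
abbrev pullbackφ (b' : B') : (E.pullback f).E b' →ₗ[ℂ] E.E (f b') := LinearMap.id

omit [T2Space B] [ParacompactSpace B] [T2Space B'] [ParacompactSpace B'] in
/-- Its total map `f^*E → E` is the canonical lift, continuous. [folklore] -/
theorem continuous_pullbackΨ : Continuous fun p : TotalSpace (E.pullback f).F (E.pullback f).E ↦
    (⟨f p.proj, E.pullbackφ f p.proj p.2⟩ : TotalSpace E.F E.E) :=
  Pullback.continuous_lift E.F E.E f

/-- **The map `u : P(f^*E) → P(E)`** (`ProjectiveBundleMap.projComp` of the identity bundle map,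
defined on all of `P(f^*E)`). [cite: HusemollerFibreBundles1994, Ch. 17 Prop. 3.3] -/
def pullbackProjMap (hE : 0 < E.rank) : C((E.pullback f).Proj, E.Proj) :=
  (E.pullback f).projComp E ((E.pullback f).k0 hE) (E.pullbackφ f) (E.continuous_pullbackΨ f) (ContinuousMap.id _)
    fun m ↦ by rw [(E.pullback f).mapDom_eq_univ E ((E.pullback f).k0 hE) (E.pullbackφ f) fun _ ↦ injective_id]; exact mem_univ _

omit [T2Space B] [ParacompactSpace B] [T2Space B'] [ParacompactSpace B'] in
/-- It covers `f`: `q ∘ u = f ∘ q'`. [folklore] -/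
theorem projMap_comp_pullbackProjMap (hE : 0 < E.rank) : E.projMap.comp (E.pullbackProjMap f hE) = f.comp (E.pullback f).projMap := rfl

/-- **`u^* x_E = x_{f^*E}`.** [cite: HusemollerFibreBundles1994, Ch. 17 Prop. 3.3] -/
theorem map_pullbackProjMap_xClass (hE : 0 < E.rank) :
    singularCohomology.map R R (E.pullbackProjMap f hE) 2 (E.xClass R hE) = (E.pullback f).xClass R hE := by
  have h := (E.pullback f).map_lineEuler_eq E ((E.pullback f).k0 hE) (E.k0 hE) (E.pullbackφ f) (E.continuous_pullbackΨ f)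
    (ContinuousMap.id _) (fun m ↦ by
      rw [(E.pullback f).mapDom_eq_univ E ((E.pullback f).k0 hE) (E.pullbackφ f) fun _ ↦ injective_id]; exact mem_univ _) R 1
  rw [singularCohomology.map_id] at h
  exact h.symm

/-- **(C₁), naturality: `cᵢ(f^*E) = f^*cᵢ(E)`.** [cite: HusemollerFibreBundles1994, Ch. 17 Prop. 3.3] -/
theorem chernClassR_pullback (i : ℕ) :
    (E.pullback f).chernClassR R i = singularCohomology.map R R f (2 * i) (E.chernClassR R i) := by
  rcases Nat.eq_zero_or_pos E.rank with h0 | hE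
  · rcases Nat.eq_zero_or_pos i with rfl | hi
    · rw [chernClassR_zero, chernClassR_zero, singularCohomology.map_one]
    · rw [E.chernClassR_of_rank_eq_zero R h0 hi.ne', (E.pullback f).chernClassR_of_rank_eq_zero R h0 hi.ne', map_zero]
  · have hfam : IsChernFamily R (E.pullback f).projMap ((E.pullback f).xClass R hE) E.rank
        (fun i ↦ singularCohomology.map R R f (2 * i) (E.chernClassR R i)) :=
      (E.isChernFamily_chernClassR R hE).comap (E.pullbackProjMap f hE) f (E.projMap_comp_pullbackProjMap f hE)
        (E.map_pullbackProjMap_xClass R f hE)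
    exact (congrFun ((E.pullback f).eq_chernClassR_of_isChernFamily R hE hfam) i).symm

end Pullback

section Iso

variable {E} {E₂ : ComplexVectorBundle.{0, 0} B} (e : E.Iso E₂)

/-- The fibrewise linear maps of an isomorphism. [folklore] -/
abbrev isoφ (b : B) : E.E b →ₗ[ℂ] E₂.E ((ContinuousMap.id B) b) := ((e.equiv b : E.E b →L[ℂ] E₂.E b) : E.E b →ₗ[ℂ] E₂.E b)

omit [T2Space B] [ParacompactSpace B] in
/-- Their total map is continuous. [folklore] -/
theorem continuous_isoΨ : Continuous fun p : TotalSpace E.F E.E ↦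
    (⟨(ContinuousMap.id B) p.proj, isoφ e p.proj p.2⟩ : TotalSpace E₂.F E₂.E) := e.continuous_toFun

/-- **The map `u : P(E₁) → P(E₂)` of an isomorphism.** [cite: HusemollerFibreBundles1994, Ch. 17 Prop. 3.3] -/
def isoProjMap (h₁ : 0 < E.rank) : C(E.Proj, E₂.Proj) :=
  E.projComp E₂ (E.k0 h₁) (isoφ e) (continuous_isoΨ e) (ContinuousMap.id _) fun m ↦ by
    rw [E.mapDom_eq_univ E₂ (E.k0 h₁) (isoφ e) fun b ↦ (e.equiv b).injective]; exact mem_univ _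

omit [T2Space B] [ParacompactSpace B] in
/-- It covers the identity. [folklore] -/
theorem projMap_comp_isoProjMap (h₁ : 0 < E.rank) :
    E₂.projMap.comp (isoProjMap e h₁) = (ContinuousMap.id B).comp E.projMap := rfl

/-- **`u^* x₂ = x₁`.** [cite: HusemollerFibreBundles1994, Ch. 17 Prop. 3.3] -/
theorem map_isoProjMap_xClass (h₁ : 0 < E.rank) (h₂ : 0 < E₂.rank) :
    singularCohomology.map R R (isoProjMap e h₁) 2 (E₂.xClass R h₂) = E.xClass R h₁ := by
  have h := E.map_lineEuler_eq E₂ (E.k0 h₁) (E₂.k0 h₂) (isoφ e) (continuous_isoΨ e) (ContinuousMap.id _) (fun m ↦ by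
    rw [E.mapDom_eq_univ E₂ (E.k0 h₁) (isoφ e) fun b ↦ (e.equiv b).injective]; exact mem_univ _) R 1
  rw [singularCohomology.map_id] at h
  exact h.symm

include e in
/-- **(C₁), invariance: `cᵢ(E₁) = cᵢ(E₂)` for `B`-isomorphic bundles.** [cite: HusemollerFibreBundles1994, Ch. 17 Prop. 3.3] -/
theorem chernClassR_congr (i : ℕ) : E.chernClassR R i = E₂.chernClassR R i := by
  rcases isEmpty_or_nonempty B with hB | hB
  · haveI := hB
    rw [ModuleCat.eq_zero_of_isZero_obj (isZero_singularCohomology_of_isEmpty' R B (2 * i)) (E.chernClassR R i),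
      ModuleCat.eq_zero_of_isZero_obj (isZero_singularCohomology_of_isEmpty' R B (2 * i)) (E₂.chernClassR R i)]
  have hr : E.rank = E₂.rank := ComplexVectorBundle.Iso.rank_eq e
  rcases Nat.eq_zero_or_pos E.rank with h0 | h₁
  · rcases Nat.eq_zero_or_pos i with rfl | hi
    · rw [chernClassR_zero, chernClassR_zero]
    · rw [E.chernClassR_of_rank_eq_zero R h0 hi.ne', E₂.chernClassR_of_rank_eq_zero R (hr ▸ h0) hi.ne']
  · have h₂ : 0 < E₂.rank := hr ▸ h₁
    -- `c(E₂)` transported along `u` is a Chern family for `(q₁, x₁, n₂)`, i.e. for `(q₁, x₁, n₁)`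
    have hfam : IsChernFamily R E.projMap (E.xClass R h₁) E₂.rank
        (fun i ↦ singularCohomology.map R R (ContinuousMap.id B) (2 * i) (E₂.chernClassR R i)) :=
      (E₂.isChernFamily_chernClassR R h₂).comap (isoProjMap e h₁) (ContinuousMap.id B) (projMap_comp_isoProjMap e h₁)
        (map_isoProjMap_xClass R e h₁ h₂)
    rw [← hr] at hfam
    have := congrFun (E.eq_chernClassR_of_isChernFamily R h₁ hfam) i
    rw [singularCohomology.map_id] at this
    exact this.symm

end Iso

end ComplexVectorBundle

end Literature.AlgebraicTopology.CharacteristicClasses
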